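import Mathlib
import Summits.CriticalPhenomena.CardyFormulaZ2.Theorems.CardyMagicRigidityMagicFormulaTUVAssemblyToolkit
import HarnessLib

/-!
# UV assembly core (crux `MagicFormulaT`, line `Sketch` v6, stub S5 `stub_uvAssembly`) — part 2/3

Crux `Summit.CriticalPhenomena.CardyFormulaZ2.Theses.CardyMagicRigidity.MagicFormulaT`
(stmt-CriticalPhenomena-4836), line `Sketch`, skeleton v6 (the UV split), registered stub S5.  The abstract,
purely measure-theoretic core of the assembly (`uva_abstract`: on a probability space, the pathwise split
`A = W S`, `W = T M`, the top bound `|T| ≤ 2^N`, the sandwiches `L_s ≤ S ≤ U_s`, `0 ≤ M ≤ U_m` and the moment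
inputs give `|EA − EW| ≤ (t/2)(C_K + E_M)/2 + (1/2t)((e^V − 1) + (e^V − 2e^{−m/c} + 1))` by AM–GM, domination
and Jensen `exp_integral_le_integral_exp`), the error function (`uva_errorFun_tendsto`) and the final arithmetic
(`uva_final_arith`, registered sub-goal).  No definition, no cited fact.
-/

noncomputable section

namespace Summit.CriticalPhenomena.CardyFormulaZ2.Cruxes.MagicFormulaT.LineSketch

open MeasureTheory Filter Set Metric
open scoped Real Topology BigOperators
open Summit.CriticalPhenomena.CardyFormulaZ2.Cruxes.NestingRigidity.PositiveConeWeightDoubling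

/-- The error function of the assembly tends to `0` with the cut-off. -/
theorem uva_errorFun_tendsto (v w c : ℝ) :
    Tendsto (fun η : ℝ ↦ (Real.exp (v * η) - 1) +
      (Real.exp (v * η) - 2 * Real.exp (-(w * η ^ 2 / c)) + 1)) (𝓝[>] 0) (𝓝 0) := by
  set F : ℝ → ℝ := fun η ↦ (Real.exp (v * η) - 1) +
    (Real.exp (v * η) - 2 * Real.exp (-(w * η ^ 2 / c)) + 1) with hF
  have hcont : Continuous F := by rw [hF]; fun_prop
  have h : Tendsto F (𝓝 0) (𝓝 (F 0)) := hcont.tendsto 0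
  have h0 : F 0 = 0 := by rw [hF]; norm_num
  rw [h0] at h
  exact tendsto_nhdsWithin_of_tendsto_nhds h

/-- Order bookkeeping: `|a| ≤ 4√3` gives `|a| κ ρ² ≤ 4√3 κ ρ²`. -/
theorem uva_order_le {a κ ρ : ℝ} (ha : |a| ≤ 4 * Real.sqrt 3) (hκ : 0 ≤ κ) :
    |a| * κ * ρ ^ 2 ≤ 4 * Real.sqrt 3 * κ * ρ ^ 2 := by
  gcongr

/-- The final arithmetic: with `t = κ/(B+1)` and an error `φ ≤ κ²/(B+1)`,
`(t/2) B + φ/(2t) ≤ κ`. -/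
theorem uva_final_arith : ∀ {κ B φ : ℝ}, 0 < κ → 0 < B → φ ≤ κ ^ 2 / (B + 1) →
    κ / (B + 1) / 2 * B + 1 / (2 * (κ / (B + 1))) * φ ≤ κ := by
  intro κ B φ hκ hB hφ
  have hB1 : 0 < B + 1 := by linarith
  have h1 : κ / (B + 1) / 2 * B ≤ κ / 2 := by
    rw [div_div, div_mul_eq_mul_div, div_le_div_iff₀ (by positivity) two_pos]
    nlinarith
  have h2 : 1 / (2 * (κ / (B + 1))) * φ ≤ κ / 2 := by
    have h2t : 0 ≤ 1 / (2 * (κ / (B + 1))) := by positivity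
    refine (mul_le_mul_of_nonneg_left hφ h2t).trans (le_of_eq ?_)
    field_simp
  linarith

/-- **The abstract core of the UV assembly** (pure measure theory on a probability space).  Given the
pathwise split `A = W S`, `W = T M`, the top bound `|T| ≤ 2^N`, the sandwiches `L_s ≤ S ≤ U_s`,
`0 ≤ M ≤ U_m` (`U_s = e^{−√3Θ_s}`, `L_s = e^{−√3Θ_s − Θ₂/c}`, `U_m = e^{−√3Θ_m}`), and the moment inputs
`E e^{(log 16) N} ≤ C_K`, `E e^{−4√3Θ_m} ≤ E_M`, `E e^{−2√3Θ_s} ≤ e^V`, `EΘ_s = 0`, `EΘ₂ ≤ m`, one has for every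
`t > 0`: `|EA − EW| ≤ (t/2)(C_K + E_M)/2 + (1/2t)((e^V − 1) + (e^V − 2e^{−m/c} + 1))`. -/
theorem uva_abstract {Ω : Type*} [MeasurableSpace Ω] {μ : Measure Ω} [IsProbabilityMeasure μ]
    {A W S T M Θs Θ₂ Θm : Ω → ℝ} {N : Ω → ℕ} {t cc CK EM V mm : ℝ} (ht : 0 < t) (hcc : 0 < cc)
    (hAW : ∀ ω, A ω = W ω * S ω) (hWTM : ∀ ω, W ω = T ω * M ω) (hT : ∀ ω, |T ω| ≤ (2 : ℝ) ^ N ω)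
    (hSl : ∀ ω, Real.exp (-(Real.sqrt 3 * Θs ω) - Θ₂ ω / cc) ≤ S ω)
    (hSu : ∀ ω, S ω ≤ Real.exp (-(Real.sqrt 3 * Θs ω)))
    (hM0 : ∀ ω, 0 ≤ M ω) (hMu : ∀ ω, M ω ≤ Real.exp (-(Real.sqrt 3 * Θm ω))) (hΘ₂0 : ∀ ω, 0 ≤ Θ₂ ω)
    (hIA : Integrable A μ) (hIW : Integrable W μ) (hΘsm : Measurable Θs) (hΘ₂m : Measurable Θ₂)
    (hIN : Integrable (fun ω ↦ Real.exp (Real.log 16 * N ω)) μ)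
    (hEN : ∫ ω, Real.exp (Real.log 16 * N ω) ∂μ ≤ CK)
    (hIM4 : Integrable (fun ω ↦ Real.exp (-(4 * Real.sqrt 3 * Θm ω))) μ)
    (hEM4 : ∫ ω, Real.exp (-(4 * Real.sqrt 3 * Θm ω)) ∂μ ≤ EM)
    (hIU : Integrable (fun ω ↦ Real.exp (-(Real.sqrt 3 * Θs ω))) μ)
    (hIU2 : Integrable (fun ω ↦ Real.exp (-(2 * Real.sqrt 3 * Θs ω))) μ)
    (hEU2 : ∫ ω, Real.exp (-(2 * Real.sqrt 3 * Θs ω)) ∂μ ≤ Real.exp V)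
    (hIΘs : Integrable Θs μ) (hEΘs : ∫ ω, Θs ω ∂μ = 0) (hIΘ₂ : Integrable Θ₂ μ)
    (hEΘ₂ : ∫ ω, Θ₂ ω ∂μ ≤ mm) :
    |∫ ω, A ω ∂μ - ∫ ω, W ω ∂μ| ≤
      t / 2 * ((CK + EM) / 2) +
        1 / (2 * t) * ((Real.exp V - 1) + (Real.exp V - 2 * Real.exp (-(mm / cc)) + 1)) := by
  /- the two exponentials of the small band -/
  set Us : Ω → ℝ := fun ω ↦ Real.exp (-(Real.sqrt 3 * Θs ω)) with hUs_def
  set Ls : Ω → ℝ := fun ω ↦ Real.exp (-(Real.sqrt 3 * Θs ω) - Θ₂ ω / cc) with hLs_def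
  have hLsU : ∀ ω, Ls ω ≤ Us ω := fun ω ↦ by
    simp only [hUs_def, hLs_def]
    exact Real.exp_le_exp.2 (by linarith [div_nonneg (hΘ₂0 ω) hcc.le])
  have hLs0 : ∀ ω, 0 < Ls ω := fun ω ↦ Real.exp_pos _
  have hUs0 : ∀ ω, 0 < Us ω := fun ω ↦ Real.exp_pos _
  -- measurability / integrability of `Ls`, `Us`, their squares
  have hUsm : Measurable Us := (hΘsm.const_mul _).neg.exp
  have hLsm : Measurable Ls := ((hΘsm.const_mul _).neg.sub (hΘ₂m.div_const _)).exp
  have hIUs : Integrable Us μ := hIU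
  have hUs2 : ∀ ω, Us ω ^ 2 = Real.exp (-(2 * Real.sqrt 3 * Θs ω)) := fun ω ↦ by
    simp only [hUs_def]
    rw [sq, ← Real.exp_add]
    congr 1; ring
  have hIUs2 : Integrable (fun ω ↦ Us ω ^ 2) μ := by
    simp_rw [hUs2]; exact hIU2
  have hILs : Integrable Ls μ :=
    Integrable.mono' hIUs hLsm.aestronglyMeasurable (Eventually.of_forall fun ω ↦ by
      rw [Real.norm_eq_abs, abs_of_pos (hLs0 ω)]; exact hLsU ω)
  have hILs2 : Integrable (fun ω ↦ Ls ω ^ 2) μ :=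
    Integrable.mono' hIUs2 (hLsm.pow_const 2).aestronglyMeasurable (Eventually.of_forall fun ω ↦ by
      rw [Real.norm_eq_abs, abs_of_nonneg (sq_nonneg _)]
      exact pow_le_pow_left₀ (hLs0 ω).le (hLsU ω) 2)
  /- the majorant of `W²` -/
  have hW2 : ∀ ω, W ω ^ 2 ≤
      (Real.exp (Real.log 16 * N ω) + Real.exp (-(4 * Real.sqrt 3 * Θm ω))) / 2 := by
    intro ω
    have hy2 : (Real.exp (-(Real.sqrt 3 * Θm ω)) ^ 2) ^ 2 = Real.exp (-(4 * Real.sqrt 3 * Θm ω)) := by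
      rw [← Real.exp_nat_mul, ← Real.exp_nat_mul]
      congr 1; push_cast; ring
    have h1 : W ω ^ 2 ≤ ((2 : ℝ) ^ N ω) ^ 2 * Real.exp (-(Real.sqrt 3 * Θm ω)) ^ 2 := by
      rw [hWTM ω, mul_pow]
      have hT2 : T ω ^ 2 ≤ ((2 : ℝ) ^ N ω) ^ 2 := by
        rw [← sq_abs (T ω)]
        exact pow_le_pow_left₀ (abs_nonneg _) (hT ω) 2
      have hM2 : M ω ^ 2 ≤ Real.exp (-(Real.sqrt 3 * Θm ω)) ^ 2 :=
        pow_le_pow_left₀ (hM0 ω) (hMu ω) 2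
      exact mul_le_mul hT2 hM2 (sq_nonneg _) (by positivity)
    refine h1.trans ?_
    rw [uva_exp_log_sixteen_mul, ← hy2]
    exact uva_four_pow_mul_le (N ω) _
  have hIW2 : Integrable (fun ω ↦ W ω ^ 2) μ :=
    Integrable.mono' ((hIN.add hIM4).div_const 2) (hIW.aestronglyMeasurable.pow 2)
      (Eventually.of_forall fun ω ↦ by
        rw [Real.norm_eq_abs, abs_of_nonneg (sq_nonneg _)]; exact hW2 ω)
  have hEW2 : ∫ ω, W ω ^ 2 ∂μ ≤ (CK + EM) / 2 := by
    calc ∫ ω, W ω ^ 2 ∂μ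
        ≤ ∫ ω, (Real.exp (Real.log 16 * N ω) + Real.exp (-(4 * Real.sqrt 3 * Θm ω))) / 2 ∂μ :=
          integral_mono_of_nonneg (Eventually.of_forall fun ω ↦ sq_nonneg _)
            ((hIN.add hIM4).div_const 2) (Eventually.of_forall hW2)
      _ = ((∫ ω, Real.exp (Real.log 16 * N ω) ∂μ) +
            ∫ ω, Real.exp (-(4 * Real.sqrt 3 * Θm ω)) ∂μ) / 2 := by
          rw [integral_div, integral_add hIN hIM4]
      _ ≤ (CK + EM) / 2 := by gcongr
  /- the error term `G = (L_s − 1)² + (U_s − 1)²` -/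
  have hIG : Integrable (fun ω ↦ (Ls ω - 1) ^ 2 + (Us ω - 1) ^ 2) μ := by
    have h : (fun ω ↦ (Ls ω - 1) ^ 2 + (Us ω - 1) ^ 2) =
        fun ω ↦ (Ls ω ^ 2 - 2 * Ls ω + 1) + (Us ω ^ 2 - 2 * Us ω + 1) := by
      funext ω; ring
    rw [h]
    exact ((hILs2.sub (hILs.const_mul 2)).add (integrable_const _)).add
      ((hIUs2.sub (hIUs.const_mul 2)).add (integrable_const _))
  -- Jensen lower bounds
  have hJU : 1 ≤ ∫ ω, Us ω ∂μ := by
    have hN : Integrable (fun ω ↦ -(Real.sqrt 3 * Θs ω)) μ := (hIΘs.const_mul _).neg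
    have h := UVExpMoments.exp_integral_le_integral_exp hN hIUs
    have h0 : ∫ ω, -(Real.sqrt 3 * Θs ω) ∂μ = 0 := by
      rw [integral_neg, integral_const_mul, hEΘs, mul_zero, neg_zero]
    rwa [h0, Real.exp_zero] at h
  have hJL : Real.exp (-(mm / cc)) ≤ ∫ ω, Ls ω ∂μ := by
    have hN1 : Integrable (fun ω ↦ -(Real.sqrt 3 * Θs ω)) μ := (hIΘs.const_mul _).neg
    have hN2 : Integrable (fun ω ↦ Θ₂ ω / cc) μ := hIΘ₂.div_const _
    have hN : Integrable (fun ω ↦ -(Real.sqrt 3 * Θs ω) - Θ₂ ω / cc) μ := hN1.sub hN2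
    have h := UVExpMoments.exp_integral_le_integral_exp hN hILs
    have h0 : ∫ ω, (-(Real.sqrt 3 * Θs ω) - Θ₂ ω / cc) ∂μ = -((∫ ω, Θ₂ ω ∂μ) / cc) := by
      rw [integral_sub hN1 hN2, integral_neg, integral_const_mul, hEΘs, mul_zero, neg_zero, zero_sub,
        integral_div]
    rw [h0] at h
    refine le_trans (Real.exp_le_exp.2 ?_) h
    exact neg_le_neg (div_le_div_of_nonneg_right hEΘ₂ hcc.le)
  have hEG : ∫ ω, ((Ls ω - 1) ^ 2 + (Us ω - 1) ^ 2) ∂μ ≤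
      (Real.exp V - 1) + (Real.exp V - 2 * Real.exp (-(mm / cc)) + 1) := by
    have hsplit : ∫ ω, ((Ls ω - 1) ^ 2 + (Us ω - 1) ^ 2) ∂μ =
        ((∫ ω, Ls ω ^ 2 ∂μ) - 2 * (∫ ω, Ls ω ∂μ) + 1) +
          ((∫ ω, Us ω ^ 2 ∂μ) - 2 * (∫ ω, Us ω ∂μ) + 1) := by
      have h : (fun ω ↦ (Ls ω - 1) ^ 2 + (Us ω - 1) ^ 2) =
          fun ω ↦ (Ls ω ^ 2 - 2 * Ls ω + 1) + (Us ω ^ 2 - 2 * Us ω + 1) := by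
        funext ω; ring
      have i5 : Integrable (fun ω ↦ 2 * Ls ω) μ := hILs.const_mul 2
      have i6 : Integrable (fun ω ↦ 2 * Us ω) μ := hIUs.const_mul 2
      have i3 : Integrable (fun ω ↦ Ls ω ^ 2 - 2 * Ls ω) μ := hILs2.sub i5
      have i4 : Integrable (fun ω ↦ Us ω ^ 2 - 2 * Us ω) μ := hIUs2.sub i6
      have i1 : Integrable (fun ω ↦ Ls ω ^ 2 - 2 * Ls ω + 1) μ := i3.add (integrable_const _)
      have i2 : Integrable (fun ω ↦ Us ω ^ 2 - 2 * Us ω + 1) μ := i4.add (integrable_const _)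
      rw [h, integral_add i1 i2, integral_add i3 (integrable_const _),
        integral_add i4 (integrable_const _), integral_sub hILs2 i5, integral_sub hIUs2 i6,
        integral_const_mul, integral_const_mul]
      simp
    have hEUs2 : ∫ ω, Us ω ^ 2 ∂μ ≤ Real.exp V := by simp_rw [hUs2]; exact hEU2
    have hELs2 : ∫ ω, Ls ω ^ 2 ∂μ ≤ Real.exp V :=
      (integral_mono hILs2 hIUs2 fun ω ↦ pow_le_pow_left₀ (hLs0 ω).le (hLsU ω) 2).trans hEUs2
    rw [hsplit]
    linarith
  /- the pathwise estimate and its integral -/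
  have hpt : ∀ ω, |A ω - W ω| ≤ t / 2 * W ω ^ 2 + 1 / (2 * t) * ((Ls ω - 1) ^ 2 + (Us ω - 1) ^ 2) := by
    intro ω
    have h1 : |A ω - W ω| = |W ω| * |S ω - 1| := by
      rw [hAW ω, ← abs_mul]; congr 1; ring
    rw [h1]
    refine (uva_abs_mul_le (W ω) (S ω - 1) ht).trans ?_
    gcongr
    exact uva_sq_sub_one_le (hSl ω) (hSu ω)
  have hIAW : Integrable (fun ω ↦ |A ω - W ω|) μ := (hIA.sub hIW).abs
  calc |∫ ω, A ω ∂μ - ∫ ω, W ω ∂μ| = |∫ ω, (A ω - W ω) ∂μ| := by rw [integral_sub hIA hIW]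
    _ ≤ ∫ ω, |A ω - W ω| ∂μ := abs_integral_le_integral_abs
    _ ≤ ∫ ω, (t / 2 * W ω ^ 2 + 1 / (2 * t) * ((Ls ω - 1) ^ 2 + (Us ω - 1) ^ 2)) ∂μ :=
        integral_mono hIAW ((hIW2.const_mul _).add (hIG.const_mul _)) hpt
    _ = t / 2 * ∫ ω, W ω ^ 2 ∂μ + 1 / (2 * t) * ∫ ω, ((Ls ω - 1) ^ 2 + (Us ω - 1) ^ 2) ∂μ := by
        rw [integral_add (hIW2.const_mul _) (hIG.const_mul _), integral_const_mul, integral_const_mul]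
    _ ≤ t / 2 * ((CK + EM) / 2) +
          1 / (2 * t) * ((Real.exp V - 1) + (Real.exp V - 2 * Real.exp (-(mm / cc)) + 1)) := by
        gcongr

end Summit.CriticalPhenomena.CardyFormulaZ2.Cruxes.MagicFormulaT.LineSketch

end
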